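import Literature.AlgebraicGeometry.Resolution.StrictTransformAffineFlat
import Literature.AlgebraicGeometry.Resolution.StrictTransformTargetLocality
import Literature.AlgebraicGeometry.Resolution.BlowupFittingIdealFlatCartier
import Mathlib.AlgebraicGeometry.Morphisms.Finite
import HarnessLib

/-!
# Raynaud–Gruson flattening for finite morphisms over an affine base (Stacks 081R / 0811)

Topic: `Literature/AlgebraicGeometry/Resolution`. The first proven instance of the conclusion of
the named fact `Stacks081R` (Raynaud–Gruson 1971, Thm. 5.2.2; The Stacks Project, Tag 081R):
let `f : X → S` be a FINITE morphism of AFFINE schemes, `B = Γ(X)` over `R = Γ(S)`, and suppose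
that `B` is locally free of rank `r` over `U = S ∖ V(I)` where `I = Fit_r(B)` (i.e.
`Iⁿ Fit_k(B) = 0` for `k < r`). Then for EVERY morphism `b : S' → S` pulling `V(I)` back to an
effective Cartier divisor — in particular for the (`U`-admissible, when `I` is of finite type)
blowing up of `S` in `I` — the strict transform `X'` of `X` (Stacks 080D (2),
`blowupStrictTransform`) is FLAT over `S'`.

Proof: flatness of `X' → S'` is local on `S'` for strict transforms
(`blowupStrictTransformMap_of_openCover_target`, `StrictTransformTargetLocality.lean`); over an
affine chart `V` of `S'` on which the pulled-back divisor is cut out by a nonzerodivisor `t`,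
`X'|_V → V` is flat iff `Γ(V) → C/(t-power torsion)` is flat, `C = Γ(X ×_S V)`
(`flat_blowupStrictTransformMap_iff_ringHom_flat`, `StrictTransformAffineFlat.lean`);
`C = Γ(V) ⊗_R B` (pushouts of global sections of affine schemes, Mathlib
`isPushout_appTop_of_isPullback`), under which that ring map becomes
`Γ(V) → (Γ(V) ⊗_R B)/(t-power torsion)`, flat by Raynaud–Gruson 5.4.2
(`flat_strictTransform_of_span`, `BlowupFittingIdealFlatCartier.lean`).

* `ringHom_flat_quotient_powTorsion_of_module_flat` — the algebraic bridge: transporting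
  flatness of the torsion quotient along a ring isomorphism `C ≅ Γ(V) ⊗_R B` over `Γ(V)`;
* `flat_blowupStrictTransformMap_of_isFinite_of_isAffine` — **the strict transform of a finite
  `X → S` (affine, locally free of rank `r` off `V(Fit_r)`) along any `b : S' → S` making
  `V(Fit_r)` an effective Cartier divisor is flat over `S'`.**

## References

* M. Raynaud, L. Gruson, *Critères de platitude et de projectivité*, Invent. Math. 13 (1971),
  Première partie, 5.2.2, 5.4.2, 5.4.3. [RaynaudGruson1971]
* The Stacks Project, Tag 081R (Lemma 38.31.1), Tag 0811, Tag 0810. [StacksProject]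
-/

noncomputable section

open CategoryTheory CategoryTheory.Limits AlgebraicGeometry TopologicalSpace TensorProduct

namespace Literature.AlgebraicGeometry.Resolution

universe u

open Literature.RingTheory.FittingIdeal Literature.AlgebraicGeometry.Limits

/-! ## Algebra: transporting flatness of the torsion quotient along a ring isomorphism -/

section Algebra

/-- Ring isomorphisms map power-torsion ideals to power-torsion ideals. [folklore] -/
theorem map_powTorsionIdeal_ringEquiv {C D : Type u} [CommRing C] [CommRing D] (E : C ≃+* D)
    (c : C) : (powTorsionIdeal c).map (E : C →+* D) = powTorsionIdeal (E c) := by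
  rw [Ideal.map_comap_of_equiv]
  ext y
  rw [Ideal.mem_comap, mem_powTorsionIdeal_iff, mem_powTorsionIdeal_iff]
  constructor
  · rintro ⟨n, hn⟩
    refine ⟨n, ?_⟩
    have h := congrArg E hn
    rwa [map_mul, map_pow, RingEquiv.apply_symm_apply, map_zero] at h
  · rintro ⟨n, hn⟩
    refine ⟨n, ?_⟩
    apply E.injective
    rw [map_mul, map_pow, RingEquiv.apply_symm_apply, map_zero, hn]

/-- The power-torsion ideal of `algebraMap t`, viewed over the base, is the `t`-power torsion
submodule. [folklore] -/
theorem restrictScalars_powTorsionIdeal_algebraMap {R' D : Type u} [CommRing R'] [CommRing D]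
    [Algebra R' D] (t : R') :
    (powTorsionIdeal (algebraMap R' D t)).restrictScalars R' =
      ⨆ n : ℕ, Submodule.torsionBy R' D (t ^ n) := by
  ext x
  rw [Submodule.restrictScalars_mem, mem_powTorsionIdeal_iff, mem_powTorsion_iff]
  simp only [Algebra.smul_def, map_pow]

/-- **The algebraic bridge.** Let `ρ₀ : R' → C` be a ring map and `E : C ≅ D` a ring
isomorphism onto an `R'`-algebra `D` with `E ∘ ρ₀ = algebraMap`, and `c ∈ C` with
`E c = algebraMap t`. If the `t`-power-torsion quotient of `D` is a flat `R'`-module, then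
`R' → C → C/(c-power torsion)` is a flat ring map. [folklore] -/
theorem ringHom_flat_quotient_powTorsion_of_module_flat {R' C D : Type u} [CommRing R']
    [CommRing C] [CommRing D] [Algebra R' D] (ρ₀ : R' →+* C) (E : C ≃+* D)
    (hE : ∀ r, E (ρ₀ r) = algebraMap R' D r) (c : C) {t : R'} (hc : E c = algebraMap R' D t)
    (hflat : Module.Flat R' (D ⧸ (⨆ n : ℕ, Submodule.torsionBy R' D (t ^ n)))) :
    ((Ideal.Quotient.mk (powTorsionIdeal c)).comp ρ₀).Flat := by
  have hJ' : powTorsionIdeal (algebraMap R' D t) = (powTorsionIdeal c).map (E : C →+* D) := by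
    rw [map_powTorsionIdeal_ringEquiv, hc]
  -- flatness of the ring quotient `D / J'` as an `R'`-module
  haveI : Module.Flat R' (D ⧸ powTorsionIdeal (algebraMap R' D t)) := by
    refine Module.Flat.of_linearEquiv (M := D ⧸ (⨆ n : ℕ, Submodule.torsionBy R' D (t ^ n)))
      ((Submodule.Quotient.restrictScalarsEquiv R' (powTorsionIdeal (algebraMap R' D t))).symm
        ≪≫ₗ Submodule.quotEquivOfEq _ _ (restrictScalars_powTorsionIdeal_algebraMap t))
  have hflat' : (algebraMap R' (D ⧸ powTorsionIdeal (algebraMap R' D t))).Flat :=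
    RingHom.flat_algebraMap_iff.mpr inferInstance
  -- `C / J ≅ D / J'` over `R'`
  let e := Ideal.quotientEquiv (powTorsionIdeal c) (powTorsionIdeal (algebraMap R' D t)) E hJ'
  have hcomp : (Ideal.Quotient.mk (powTorsionIdeal c)).comp ρ₀ =
      e.symm.toRingHom.comp (algebraMap R' (D ⧸ powTorsionIdeal (algebraMap R' D t))) := by
    ext r
    change _ = e.symm (Ideal.Quotient.mk _ (algebraMap R' D r))
    rw [← hE r, Ideal.quotientEquiv_symm_mk, RingEquiv.symm_apply_apply]
    rfl
  rw [hcomp]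
  exact RingHom.Flat.respectsIso.1 _ e.symm hflat'

end Algebra

/-! ## Raynaud–Gruson flattening for finite morphisms of affine schemes -/

section Scheme

variable {X S : Scheme.{u}} [IsAffine X] [IsAffine S] (f : X ⟶ S)

/-- A bijective ring map preserves nonzerodivisors. [folklore] -/
theorem mem_nonZeroDivisors_map_of_bijective {A B : Type u} [CommRing A] [CommRing B]
    (φ : A →+* B) (hφ : Function.Bijective φ) {a : A} (ha : a ∈ nonZeroDivisors A) :
    φ a ∈ nonZeroDivisors B := by
  refine mem_nonZeroDivisors_iff_right.mpr fun y hy => ?_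
  obtain ⟨x, rfl⟩ := hφ.2 y
  rw [← map_mul, ← map_zero φ] at hy
  rw [(mem_nonZeroDivisors_iff_right.mp ha) _ (hφ.1 hy), map_zero]

/-- **Raynaud–Gruson flattening for a finite morphism over an affine base** (the conclusion
of Stacks 081R in this case; Raynaud–Gruson 5.4.2–5.4.3, Stacks 0811). Let `f : X → S` be a
finite morphism of affine schemes, `R = Γ(S)`, `B = Γ(X)`, `r ≥ 0`, `I = Fit_r(B)`, and
suppose `B` is locally free of rank `r` over `S ∖ V(I)` (`Iⁿ · Fit_k(B) = 0` for `k < r`).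
Then for every `b : S' → S` such that `b⁻¹(I) 𝒪_{S'}` is an effective Cartier divisor — e.g.
the blowing up of `S` in `I` — the strict transform of `X` along `b` is flat over `S'`.
[cite: RaynaudGruson1971, Première partie 5.4.2; StacksProject, Tag 081R] -/
theorem flat_blowupStrictTransformMap_of_isFinite_of_isAffine [IsFinite f] {r : ℕ}
    {I : Ideal Γ(S, ⊤)}
    (hI : letI := f.appTop.hom.toAlgebra; Module.fittingIdeal Γ(S, ⊤) Γ(X, ⊤) r = I)
    (htors : letI := f.appTop.hom.toAlgebra;
      ∀ k < r, ∃ n : ℕ, I ^ n * Module.fittingIdeal Γ(S, ⊤) Γ(X, ⊤) k = ⊥)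
    {S' : Scheme.{u}} (b : S' ⟶ S)
    (hb : IsEffectiveCartier ((Scheme.IdealSheafData.ofIdealTop I).comap b)) :
    Flat (blowupStrictTransformMap f b (Scheme.IdealSheafData.ofIdealTop I)) := by
  letI algB : Algebra Γ(S, ⊤) Γ(X, ⊤) := f.appTop.hom.toAlgebra
  haveI : Module.Finite Γ(S, ⊤) Γ(X, ⊤) :=
    ((HasAffineProperty.iff_of_isAffine (P := @IsFinite) (f := f)).mp inferInstance).2
  have hb' := hb
  -- the Cartier charts of `S'` and the associated open cover
  choose V hxV t ht htV using hb
  let 𝒰 : S'.OpenCover := Scheme.Cover.mkOfCovers S' (fun x => ((V x : S'.Opens) : Scheme.{u}))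
    (fun x => (V x : S'.Opens).ι) (fun x => ⟨x, ⟨x, hxV x⟩, rfl⟩) (fun x => inferInstance)
  refine blowupStrictTransformMap_of_openCover_target f b _ @Flat hb' 𝒰 fun x => ?_
  change (S' : Type u) at x
  show Flat (blowupStrictTransformMap f ((V x : S'.Opens).ι ≫ b) (Scheme.IdealSheafData.ofIdealTop I))
  -- notation for the chart
  haveI : IsAffine ((V x : S'.Opens) : Scheme.{u}) := (V x).2
  have hTW : (⊤ : ((V x : S'.Opens) : Scheme.{u}).Opens) ≤
      (V x : S'.Opens).ι ⁻¹ᵁ (V x : S'.Opens) :=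
    le_top.trans (Scheme.Opens.ι_preimage_self _).ge
  -- the generator `t'` on the whole chart, a nonzerodivisor
  have hbij : Function.Bijective ((V x : S'.Opens).ι.appLE (V x) ⊤ hTW).hom :=
    ConcreteCategory.bijective_of_isIso _
  have ht' : ((V x : S'.Opens).ι.appLE (V x) ⊤ hTW) (t x) ∈
      nonZeroDivisors Γ((V x : S'.Opens), ⊤) :=
    mem_nonZeroDivisors_map_of_bijective _ hbij (ht x)
  -- the pulled-back ideal on the chart is generated by `t'` …
  have hideal : ((Scheme.IdealSheafData.ofIdealTop I).comap ((V x : S'.Opens).ι ≫ b)).ideal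
      ⟨⊤, isAffineOpen_top _⟩ = Ideal.span {((V x : S'.Opens).ι.appLE (V x) ⊤ hTW) (t x)} := by
    rw [Scheme.IdealSheafData.comap_comp, ideal_comap_eq_map_of_le (V x : S'.Opens).ι _ (V x)
      ⟨⊤, isAffineOpen_top _⟩ hTW, htV x, Ideal.map_span, Set.image_singleton]
  -- … and is the extension of `I` along `Γ(S) → Γ(V x)`
  have hIR' : I.map ((V x : S'.Opens).ι ≫ b).appTop.hom =
      Ideal.span {((V x : S'.Opens).ι.appLE (V x) ⊤ hTW) (t x)} := by
    rw [← hideal]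
    have h := ideal_comap_preimage ((V x : S'.Opens).ι ≫ b) (Scheme.IdealSheafData.ofIdealTop I)
      ⟨⊤, isAffineOpen_top _⟩ (isAffineOpen_top _)
    rw [Scheme.IdealSheafData.ofIdealTop_ideal,
      show (homOfLE (le_top : ((⟨⊤, isAffineOpen_top S⟩ : S.affineOpens) : S.Opens) ≤ ⊤)).op =
        𝟙 _ from Subsingleton.elim _ _, CategoryTheory.Functor.map_id, CommRingCat.hom_id,
      Ideal.map_id] at h
    exact h.symm
  -- the complement of the divisor on the chart is `D(t')`
  have hO : ((V x : S'.Opens).ι ≫ b) ⁻¹ᵁ centreCompl (Scheme.IdealSheafData.ofIdealTop I) =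
      ((V x : S'.Opens) : Scheme.{u}).basicOpen (((V x : S'.Opens).ι.appLE (V x) ⊤ hTW) (t x)) := by
    rw [preimage_centreCompl]
    apply Opens.ext
    have h := inter_centreCompl_eq_basicOpen (⟨⊤, isAffineOpen_top _⟩ :
      ((V x : S'.Opens) : Scheme.{u}).affineOpens) _ hideal
    simpa only [Opens.coe_top, Set.univ_inter] using h
  have hEV : IsEffectiveCartier ((Scheme.IdealSheafData.ofIdealTop I).comap
      ((V x : S'.Opens).ι ≫ b)) := by
    rw [Scheme.IdealSheafData.comap_comp]
    exact hb'.comap_of_isOpenImmersion _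
  -- flatness over the chart is flatness of the torsion quotient
  refine (flat_blowupStrictTransformMap_iff_ringHom_flat f ((V x : S'.Opens).ι ≫ b) _ hEV _ hO).mpr ?_
  -- `Γ(X ×_S V) ≅ Γ(V) ⊗_R B` over `Γ(V)`
  letI algR' : Algebra Γ(S, ⊤) Γ((V x : S'.Opens), ⊤) := ((V x : S'.Opens).ι ≫ b).appTop.hom.toAlgebra
  have hpo₁ := (isPushout_appTop_of_isPullback (IsPullback.of_hasPullback f ((V x : S'.Opens).ι ≫ b))).flip
  have hpo₂ : IsPushout ((V x : S'.Opens).ι ≫ b).appTop f.appTop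
      (CommRingCat.ofHom (Algebra.TensorProduct.includeLeftRingHom (R := Γ(S, ⊤))
        (A := Γ((V x : S'.Opens), ⊤)) (B := Γ(X, ⊤))))
      (CommRingCat.ofHom (Algebra.TensorProduct.includeRight (R := Γ(S, ⊤))
        (A := Γ((V x : S'.Opens), ⊤)) (B := Γ(X, ⊤))).toRingHom) :=
    CommRingCat.isPushout_tensorProduct Γ(S, ⊤) Γ((V x : S'.Opens), ⊤) Γ(X, ⊤)
  let E := (hpo₁.isoIsPushout _ _ hpo₂).commRingCatIsoToRingEquiv
  have hE : ∀ y, E ((pullback.snd f ((V x : S'.Opens).ι ≫ b)).appTop y) =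
      algebraMap Γ((V x : S'.Opens), ⊤) (Γ((V x : S'.Opens), ⊤) ⊗[Γ(S, ⊤)] Γ(X, ⊤)) y := fun y => by
    change ((pullback.snd f ((V x : S'.Opens).ι ≫ b)).appTop ≫ (hpo₁.isoIsPushout _ _ hpo₂).hom) y = _
    rw [hpo₁.inl_isoIsPushout_hom]
    rfl
  exact ringHom_flat_quotient_powTorsion_of_module_flat _ E hE _ (hE _)
    (flat_strictTransform_of_span (R := Γ(S, ⊤)) (B := Γ(X, ⊤)) hI htors hIR' ht')

end Scheme

end Literature.AlgebraicGeometry.Resolution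

end
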